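import Summits.QuantumFields.BalabanUV.Beta.GAN24.FaceWordEEDeep
import Summits.QuantumFields.BalabanUV.Beta.GAN24.FaceWordEEDiagDeep
import Summits.QuantumFields.BalabanUV.Beta.GAN24.FaceWordSwapGeneric

/-!
# `BalabanUV.Beta.GAN24.FaceWordEESwapDeep` — binder row G-an2-4 ∕ (CONV-C), W-slot (α-0), ROW (C)sym AT LEVELS `≥ 1`, typer's PART VI row **T6-VAL**, the (γ) hand's
# letter **K7-a (EE sector): THE SWAPPED WORD AND THE DIAGONAL PATTERNS IN leaf-02 PART 45's OUTPUT FORM** —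
# (i) the SWAPPED exchange face word (Part 45 `faceWord_swap_eq`'s output, `((S ν t ∘ X) ∘ S μ rr)`, cell bond `rr` on the RIGHT) is the DIRECT word with the bond
# directions exchanged (leaf-06 K4a moves the cell from `rr` to `t`: `swapWord_eq_directWord`, generic `S`, `X`); (ii) hence for road-P2's unit-scaled E-sector table its
# value at the deep period is `K_E²·(−½)(½)·sf²·( wVH⁻¹⟨q^{(Lc·N)}_{να}, E2_{j+1} q^{(Lc·N)}_{μβ}⟩ − wVH⁻¹Lc^{2(d+1)}⟨q^{(N)}_{να}, E2_{j+2} q^{(N)}_{μβ}⟩ )` (`ν ≠ α`, `μ ≠ β`,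
# `faceWordEE_swap_deep_value`); (iii) the direct word vanishes for `ν = β` or `μ = α`, the swapped word for `ν = α` or `μ = β` (`…_eq_zero_of_…`)
# (G-an2-4 CRUX TEAM (2), seat `b2b-balaban-gan24-formalise-leaf-06` = the (γ) hand, gen 56; journal [GAN24LEAF06-G56-INTENT5])

NOT IN PRINT; OUR BOOKKEEPING ([folklore] BY NAME over leaf-06 K4a `JointPeriodicCellSwap.sum_box_tsum_swap_weight`, leaf-02 Part 45 `FaceWordsDeepCurrents.mixed_translate ∕
tsum_weightPair_shiftK ∕ summable_word_fine ∕ summable_word_fine_left`, this seat's `FaceWordCellPairingDeep ∕ FaceWordEEDeep ∕ FaceWordEEDiagDeep`; 0 `def`, 0 cited fact,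
0 `def … : Prop`, 0 sorry).  HONEST FRAMING (cell contract, verbatim): «discharging `BetaPertH` makes Bałaban's UV stability UNCONDITIONAL — a real constructive-QFT result; it is
NOT the continuum limit and NOT the Clay problem.»  HONEST DEPENDENCY (verbatim): «continuum YM on T⁴ ⇐ BetaPertH ∧ nine spine estimates (0/9 proved); BetaPertH ⇐ (D1) ∧ (D4) ∧
CAP+tail; G-an2-4 gates asym, D1 and NE2/3/4.»

WHAT ([folklore]; v2 = v1 with §1 `swapWord_eq_directWord` RE-CUT into `FaceWordSwapGeneric` (gen 57), imported BY NAME): §2 for `S^E = unitS sf sm (cE • e3OfK Lc G_j (SrecAt … j))`, `X̃♮_{j+1}`, period `Lc·N`: `faceWordEE_deep_eq_zero_of_right_diag ∕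
_of_left_diag` (direct word, `ν = β` ∕ `μ = α`), **`faceWordEE_swap_deep_value`** (`ν ≠ α`, `μ ≠ β`), `faceWordEE_swap_deep_eq_zero_of_left_diag ∕ _of_right_diag` (`ν = α` ∕ `μ = β`).
With `FaceWordEEDeep.faceWordEE_deep_value` BOTH exchange face words of Part 47's three are valued on every index pattern; the W-word is leaf-02 Part 48's; the `LS` ∕ `FFsym`
assembly with Part 47's scalar is road-P2's ∕ leaf-02's adapter and is NOT here.  Asserts NO value of Bałaban's tables beyond these identities; discharges NOTHING of `hX` ∕ `hXu` ∕
(C)_{≥1} ∕ `hB0` ∕ `hBF` ∕ (Q-L) ∕ (hW, hWall); NEVER «G-an2-4 closed» as (CONV-C); NOT D1, NOT `BetaPertH`, NOT continuum, NOT Clay.  2026-08-24; no existing file touched.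
-/

noncomputable section

open Finset
open scoped BigOperators
open Literature.MathematicalPhysics.QuantumFieldTheory
open Literature.MathematicalPhysics.QuantumFieldTheory.Balaban1983to89
open Literature.MathematicalPhysics.QuantumFieldTheory.Balaban1983to89.Beta
open ExpKernelCalculus (Site MKer Decays BiLoc shiftK comp)
open OneStepResolventKernel (Fib LocStencil)
open OneStepKernelFamily (KInvStep)
open AffineAveraging (box toSite)
open BalabanStepJetsSucc (E2 wVH)
open Summit.QuantumFields.BalabanUV.Beta.AxialDressingRooted (coDressKBmAt one_le_of_neZero)
open Summit.QuantumFields.BalabanUV.Beta.HessKerDressedUnits (unitK unitS)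
open Summit.QuantumFields.BalabanUV.Beta.SpineRooted (e3OfK)
open Summit.QuantumFields.BalabanUV.Beta.WardLocusRecursive (SrecAt)
open Summit.QuantumFields.BalabanUV.Beta.GAN24.JointPeriodicCellSwap (sum_box_tsum_swap_weight)
open Summit.QuantumFields.BalabanUV.Beta.GAN24.FaceWordsDeepCurrents (mixed_translate tsum_weightPair_shiftK summable_word_fine summable_word_fine_left)
open Summit.QuantumFields.BalabanUV.Beta.GAN24.FaceWordCellPairingDeep (faceWord_eq_cellPairing)
open Summit.QuantumFields.BalabanUV.Beta.GAN24.FaceWordSwapGeneric (swapWord_eq_directWord)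
open Summit.QuantumFields.BalabanUV.Beta.GAN24.FaceWordEEDeep (sectorE_inr_left sectorE_inr_right sectorE_translate exists_common_rate dressedStep_invariant_deep
  faceWordEE_deep_value)
open Summit.QuantumFields.BalabanUV.Beta.GAN24.FaceWordEEDiagDeep (cellPairing_deep_eq_zero_of_right_diag_units cellPairing_deep_eq_zero_of_left_diag_units)

namespace Summit.QuantumFields.BalabanUV.Beta.GAN24.FaceWordEESwapDeep

variable {d : ℕ}

/-! ## §1 The swapped word is the direct word with the bond directions exchanged -/



/-! ## §2 road-P2's unit-scaled E-sector table: the swapped word valued, and the diagonal zeros of both words -/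

section SectorE

variable {Lc : ℕ} [NeZero Lc] {r : Fin (d + 1) → ℕ}

/-- NOT IN PRINT; OUR BOOKKEEPING.  **THE DIRECT E⊗E FACE WORD VANISHES FOR `ν = β`** (Part 45's output form; `FaceWordCellPairingDeep` ⨾ `FaceWordEEDiagDeep`). -/
theorem faceWordEE_deep_eq_zero_of_right_diag (hr : r ∈ box (d + 1) Lc) (sf sm cE cΛ : ℝ) (j N : ℕ) [NeZero N] (μ α ν : Fin (d + 1)) :
    ∑ rr ∈ box (d + 1) (Lc * N), ∑' t : Site (d + 1),
        (if toSite rr μ % ((Lc * N : ℕ) : ℤ) = ((Lc * N : ℕ) : ℤ) - 1 then (1 : ℝ) else 0) * (if t ν % ((Lc * N : ℕ) : ℤ) = ((Lc * N : ℕ) : ℤ) - 1 then (1 : ℝ) else 0) *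
        ∑' yw : Site (d + 1) × Site (d + 1),
          (if yw.1 α % ((Lc * N : ℕ) : ℤ) = ((Lc * N : ℕ) : ℤ) - 1 then (1 : ℝ) else 0) * (if yw.2 ν % ((Lc * N : ℕ) : ℤ) = ((Lc * N : ℕ) : ℤ) - 1 then (1 : ℝ) else 0) *
          comp (comp (unitS sf sm (fun κ u => cE • e3OfK Lc (coDressKBmAt (toSite r) Lc (KInvStep (d := d) Lc j))
              (SrecAt d Lc (toSite r) ((Lc : ℝ) ^ (d + 1)) (-((Lc : ℝ) ^ (d + 1) * (1 / 2) * (Lc : ℝ) ^ (d + 1))) cΛ j) κ u) μ (toSite rr))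
            (unitK sf sm (coDressKBmAt (toSite r) Lc (KInvStep (d := d) Lc (j + 1)))))
            (unitS sf sm (fun κ u => cE • e3OfK Lc (coDressKBmAt (toSite r) Lc (KInvStep (d := d) Lc j))
              (SrecAt d Lc (toSite r) ((Lc : ℝ) ^ (d + 1)) (-((Lc : ℝ) ^ (d + 1) * (1 / 2) * (Lc : ℝ) ^ (d + 1))) cΛ j) κ u) ν t)
            yw.1 yw.2 (Sum.inl α) (Sum.inl ν) = 0 := by
  haveI : NeZero (Lc * N) := ⟨Nat.mul_ne_zero (NeZero.ne Lc) (NeZero.ne N)⟩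
  obtain ⟨Cs, CX, m, hm, hS, hX⟩ := exists_common_rate (d := d) hr sf sm cE cΛ j
  rw [faceWord_eq_cellPairing (N := Lc * N) hS hX hm
      (fun κ t s => sectorE_translate (r := r) sf sm cE cΛ j κ t (((Lc * N : ℕ) : ℤ) • s))
      (fun s => dressedStep_invariant_deep (r := r) sf sm j N s)
      (fun κ t y x m b => sectorE_inr_left (r := r) sf sm cE cΛ j κ t y x m b)
      (fun κ t y x a m => sectorE_inr_right (r := r) sf sm cE cΛ j κ t y x a m) μ ν α ν]
  exact cellPairing_deep_eq_zero_of_right_diag_units hr sf sm cE cΛ j N μ α ν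

/-- NOT IN PRINT; OUR BOOKKEEPING.  **THE DIRECT E⊗E FACE WORD VANISHES FOR `μ = α`**. -/
theorem faceWordEE_deep_eq_zero_of_left_diag (hr : r ∈ box (d + 1) Lc) (sf sm cE cΛ : ℝ) (j N : ℕ) [NeZero N] (μ ν β : Fin (d + 1)) :
    ∑ rr ∈ box (d + 1) (Lc * N), ∑' t : Site (d + 1),
        (if toSite rr μ % ((Lc * N : ℕ) : ℤ) = ((Lc * N : ℕ) : ℤ) - 1 then (1 : ℝ) else 0) * (if t ν % ((Lc * N : ℕ) : ℤ) = ((Lc * N : ℕ) : ℤ) - 1 then (1 : ℝ) else 0) *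
        ∑' yw : Site (d + 1) × Site (d + 1),
          (if yw.1 μ % ((Lc * N : ℕ) : ℤ) = ((Lc * N : ℕ) : ℤ) - 1 then (1 : ℝ) else 0) * (if yw.2 β % ((Lc * N : ℕ) : ℤ) = ((Lc * N : ℕ) : ℤ) - 1 then (1 : ℝ) else 0) *
          comp (comp (unitS sf sm (fun κ u => cE • e3OfK Lc (coDressKBmAt (toSite r) Lc (KInvStep (d := d) Lc j))
              (SrecAt d Lc (toSite r) ((Lc : ℝ) ^ (d + 1)) (-((Lc : ℝ) ^ (d + 1) * (1 / 2) * (Lc : ℝ) ^ (d + 1))) cΛ j) κ u) μ (toSite rr))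
            (unitK sf sm (coDressKBmAt (toSite r) Lc (KInvStep (d := d) Lc (j + 1)))))
            (unitS sf sm (fun κ u => cE • e3OfK Lc (coDressKBmAt (toSite r) Lc (KInvStep (d := d) Lc j))
              (SrecAt d Lc (toSite r) ((Lc : ℝ) ^ (d + 1)) (-((Lc : ℝ) ^ (d + 1) * (1 / 2) * (Lc : ℝ) ^ (d + 1))) cΛ j) κ u) ν t)
            yw.1 yw.2 (Sum.inl μ) (Sum.inl β) = 0 := by
  haveI : NeZero (Lc * N) := ⟨Nat.mul_ne_zero (NeZero.ne Lc) (NeZero.ne N)⟩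
  obtain ⟨Cs, CX, m, hm, hS, hX⟩ := exists_common_rate (d := d) hr sf sm cE cΛ j
  rw [faceWord_eq_cellPairing (N := Lc * N) hS hX hm
      (fun κ t s => sectorE_translate (r := r) sf sm cE cΛ j κ t (((Lc * N : ℕ) : ℤ) • s))
      (fun s => dressedStep_invariant_deep (r := r) sf sm j N s)
      (fun κ t y x m b => sectorE_inr_left (r := r) sf sm cE cΛ j κ t y x m b)
      (fun κ t y x a m => sectorE_inr_right (r := r) sf sm cE cΛ j κ t y x a m) μ ν μ β]
  exact cellPairing_deep_eq_zero_of_left_diag_units hr sf sm cE cΛ j N μ ν β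

/-- NOT IN PRINT; OUR BOOKKEEPING.  **THE SWAPPED E⊗E FACE WORD AT THE DEEP PERIOD, VALUED** (`ν ≠ α`, `μ ≠ β`): Part 45 `faceWord_swap_eq`'s output word for `S^E` through
`X̃♮_{j+1}` equals `K_E²·(−½)(½)·sf²·( wVH⁻¹⟨q^{(Lc·N)}_{να}, E2_{j+1} q^{(Lc·N)}_{μβ}⟩_{box(Lc·N)} − wVH⁻¹·Lc^{d+1}Lc^{d+1}·⟨q^{(N)}_{να}, E2_{j+2} q^{(N)}_{μβ}⟩_{box N} )`. -/
theorem faceWordEE_swap_deep_value (hr : r ∈ box (d + 1) Lc) (sf sm cE cΛ : ℝ) (j N : ℕ) [NeZero N] {μ α ν β : Fin (d + 1)} (hνα : ν ≠ α) (hμβ : μ ≠ β) :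
    ∑ rr ∈ box (d + 1) (Lc * N), ∑' t : Site (d + 1),
        (if toSite rr μ % ((Lc * N : ℕ) : ℤ) = ((Lc * N : ℕ) : ℤ) - 1 then (1 : ℝ) else 0) * (if t ν % ((Lc * N : ℕ) : ℤ) = ((Lc * N : ℕ) : ℤ) - 1 then (1 : ℝ) else 0) *
        ∑' yw : Site (d + 1) × Site (d + 1),
          (if yw.1 α % ((Lc * N : ℕ) : ℤ) = ((Lc * N : ℕ) : ℤ) - 1 then (1 : ℝ) else 0) * (if yw.2 β % ((Lc * N : ℕ) : ℤ) = ((Lc * N : ℕ) : ℤ) - 1 then (1 : ℝ) else 0) *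
          comp (comp (unitS sf sm (fun κ u => cE • e3OfK Lc (coDressKBmAt (toSite r) Lc (KInvStep (d := d) Lc j))
              (SrecAt d Lc (toSite r) ((Lc : ℝ) ^ (d + 1)) (-((Lc : ℝ) ^ (d + 1) * (1 / 2) * (Lc : ℝ) ^ (d + 1))) cΛ j) κ u) ν t)
            (unitK sf sm (coDressKBmAt (toSite r) Lc (KInvStep (d := d) Lc (j + 1)))))
            (unitS sf sm (fun κ u => cE • e3OfK Lc (coDressKBmAt (toSite r) Lc (KInvStep (d := d) Lc j))
              (SrecAt d Lc (toSite r) ((Lc : ℝ) ^ (d + 1)) (-((Lc : ℝ) ^ (d + 1) * (1 / 2) * (Lc : ℝ) ^ (d + 1))) cΛ j) κ u) μ (toSite rr))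
            yw.1 yw.2 (Sum.inl α) (Sum.inl β) =
      (((sf * sm)⁻¹ * (sf⁻¹ * sf⁻¹) * cE) * ((sf * sm)⁻¹ * (sf⁻¹ * sf⁻¹) * cE)) *
      ((-(1 / 2 : ℝ)) * (1 / 2 : ℝ) * ((sf * sf) *
        ((wVH d Lc (j + 1))⁻¹ *
            ∑ x ∈ box (d + 1) (Lc * N), ∑ b : Fin (d + 1),
              ((if b = ν then ((((Lc * N : ℕ) : ℝ))⁻¹ * (((Lc * N : ℕ) : ℝ))⁻¹) * ((((toSite x α % ((Lc * N : ℕ) : ℤ) : ℤ) : ℝ) - ((((Lc * N : ℕ) : ℝ)) - 1) / 2)) else 0)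
                + (if b = α then (-(((Lc * N : ℕ) : ℝ))⁻¹ * ((((toSite x ν % ((Lc * N : ℕ) : ℤ) : ℤ) : ℝ) - ((((Lc * N : ℕ) : ℝ)) - 1) / 2))) *
                    (if toSite x α % ((Lc * N : ℕ) : ℤ) = ((Lc * N : ℕ) : ℤ) - 1 then (1 : ℝ) else 0) else 0)) *
              ∑' s : Site (d + 1), ∑ b' : Fin (d + 1), E2 d Lc (j + 1) (toSite x) s (Sum.inl b) (Sum.inl b') *
                ((if b' = μ then ((((Lc * N : ℕ) : ℝ))⁻¹ * (((Lc * N : ℕ) : ℝ))⁻¹) * ((((s β % ((Lc * N : ℕ) : ℤ) : ℤ) : ℝ) - ((((Lc * N : ℕ) : ℝ)) - 1) / 2)) else 0)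
                  + (if b' = β then (-(((Lc * N : ℕ) : ℝ))⁻¹ * ((((s μ % ((Lc * N : ℕ) : ℤ) : ℤ) : ℝ) - ((((Lc * N : ℕ) : ℝ)) - 1) / 2))) *
                      (if s β % ((Lc * N : ℕ) : ℤ) = ((Lc * N : ℕ) : ℤ) - 1 then (1 : ℝ) else 0) else 0)) -
          (wVH d Lc (j + 1))⁻¹ * (((Lc : ℝ) ^ (d + 1) * (Lc : ℝ) ^ (d + 1)) *
            ∑ y ∈ box (d + 1) N, ∑ a : Fin (d + 1),
              ((if a = ν then (((N : ℝ))⁻¹ * ((N : ℝ))⁻¹) * ((((toSite y α % (N : ℤ)) : ℤ) : ℝ) - ((N : ℝ) - 1) / 2) else 0)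
                + (if a = α then (-((N : ℝ))⁻¹ * ((((toSite y ν % (N : ℤ)) : ℤ) : ℝ) - ((N : ℝ) - 1) / 2)) *
                    (if toSite y α % (N : ℤ) = (N : ℤ) - 1 then (1 : ℝ) else 0) else 0)) *
              ∑' s : Site (d + 1), ∑ b' : Fin (d + 1), E2 d Lc (j + 2) (toSite y) s (Sum.inl a) (Sum.inl b') *
                ((if b' = μ then (((N : ℝ))⁻¹ * ((N : ℝ))⁻¹) * ((((s β % (N : ℤ)) : ℤ) : ℝ) - ((N : ℝ) - 1) / 2) else 0)
                  + (if b' = β then (-((N : ℝ))⁻¹ * ((((s μ % (N : ℤ)) : ℤ) : ℝ) - ((N : ℝ) - 1) / 2)) *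
                      (if s β % (N : ℤ) = (N : ℤ) - 1 then (1 : ℝ) else 0) else 0)))))) := by
  haveI : NeZero (Lc * N) := ⟨Nat.mul_ne_zero (NeZero.ne Lc) (NeZero.ne N)⟩
  obtain ⟨Cs, CX, m, hm, hS, hX⟩ := exists_common_rate (d := d) hr sf sm cE cΛ j
  rw [swapWord_eq_directWord (N := Lc * N) hS hX hm
      (fun κ t s => sectorE_translate (r := r) sf sm cE cΛ j κ t (((Lc * N : ℕ) : ℤ) • s))
      (fun s => dressedStep_invariant_deep (r := r) sf sm j N s) μ ν α β]
  exact faceWordEE_deep_value hr sf sm cE cΛ j N hνα hμβ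

/-- NOT IN PRINT; OUR BOOKKEEPING.  **THE SWAPPED E⊗E FACE WORD VANISHES FOR `ν = α`** (its left current is diagonal). -/
theorem faceWordEE_swap_deep_eq_zero_of_left_diag (hr : r ∈ box (d + 1) Lc) (sf sm cE cΛ : ℝ) (j N : ℕ) [NeZero N] (μ ν β : Fin (d + 1)) :
    ∑ rr ∈ box (d + 1) (Lc * N), ∑' t : Site (d + 1),
        (if toSite rr μ % ((Lc * N : ℕ) : ℤ) = ((Lc * N : ℕ) : ℤ) - 1 then (1 : ℝ) else 0) * (if t ν % ((Lc * N : ℕ) : ℤ) = ((Lc * N : ℕ) : ℤ) - 1 then (1 : ℝ) else 0) *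
        ∑' yw : Site (d + 1) × Site (d + 1),
          (if yw.1 ν % ((Lc * N : ℕ) : ℤ) = ((Lc * N : ℕ) : ℤ) - 1 then (1 : ℝ) else 0) * (if yw.2 β % ((Lc * N : ℕ) : ℤ) = ((Lc * N : ℕ) : ℤ) - 1 then (1 : ℝ) else 0) *
          comp (comp (unitS sf sm (fun κ u => cE • e3OfK Lc (coDressKBmAt (toSite r) Lc (KInvStep (d := d) Lc j))
              (SrecAt d Lc (toSite r) ((Lc : ℝ) ^ (d + 1)) (-((Lc : ℝ) ^ (d + 1) * (1 / 2) * (Lc : ℝ) ^ (d + 1))) cΛ j) κ u) ν t)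
            (unitK sf sm (coDressKBmAt (toSite r) Lc (KInvStep (d := d) Lc (j + 1)))))
            (unitS sf sm (fun κ u => cE • e3OfK Lc (coDressKBmAt (toSite r) Lc (KInvStep (d := d) Lc j))
              (SrecAt d Lc (toSite r) ((Lc : ℝ) ^ (d + 1)) (-((Lc : ℝ) ^ (d + 1) * (1 / 2) * (Lc : ℝ) ^ (d + 1))) cΛ j) κ u) μ (toSite rr))
            yw.1 yw.2 (Sum.inl ν) (Sum.inl β) = 0 := by
  haveI : NeZero (Lc * N) := ⟨Nat.mul_ne_zero (NeZero.ne Lc) (NeZero.ne N)⟩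
  obtain ⟨Cs, CX, m, hm, hS, hX⟩ := exists_common_rate (d := d) hr sf sm cE cΛ j
  rw [swapWord_eq_directWord (N := Lc * N) hS hX hm
      (fun κ t s => sectorE_translate (r := r) sf sm cE cΛ j κ t (((Lc * N : ℕ) : ℤ) • s))
      (fun s => dressedStep_invariant_deep (r := r) sf sm j N s) μ ν ν β]
  exact faceWordEE_deep_eq_zero_of_left_diag hr sf sm cE cΛ j N ν μ β

/-- NOT IN PRINT; OUR BOOKKEEPING.  **THE SWAPPED E⊗E FACE WORD VANISHES FOR `μ = β`** (its right current is diagonal). -/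
theorem faceWordEE_swap_deep_eq_zero_of_right_diag (hr : r ∈ box (d + 1) Lc) (sf sm cE cΛ : ℝ) (j N : ℕ) [NeZero N] (μ ν α : Fin (d + 1)) :
    ∑ rr ∈ box (d + 1) (Lc * N), ∑' t : Site (d + 1),
        (if toSite rr μ % ((Lc * N : ℕ) : ℤ) = ((Lc * N : ℕ) : ℤ) - 1 then (1 : ℝ) else 0) * (if t ν % ((Lc * N : ℕ) : ℤ) = ((Lc * N : ℕ) : ℤ) - 1 then (1 : ℝ) else 0) *
        ∑' yw : Site (d + 1) × Site (d + 1),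
          (if yw.1 α % ((Lc * N : ℕ) : ℤ) = ((Lc * N : ℕ) : ℤ) - 1 then (1 : ℝ) else 0) * (if yw.2 μ % ((Lc * N : ℕ) : ℤ) = ((Lc * N : ℕ) : ℤ) - 1 then (1 : ℝ) else 0) *
          comp (comp (unitS sf sm (fun κ u => cE • e3OfK Lc (coDressKBmAt (toSite r) Lc (KInvStep (d := d) Lc j))
              (SrecAt d Lc (toSite r) ((Lc : ℝ) ^ (d + 1)) (-((Lc : ℝ) ^ (d + 1) * (1 / 2) * (Lc : ℝ) ^ (d + 1))) cΛ j) κ u) ν t)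
            (unitK sf sm (coDressKBmAt (toSite r) Lc (KInvStep (d := d) Lc (j + 1)))))
            (unitS sf sm (fun κ u => cE • e3OfK Lc (coDressKBmAt (toSite r) Lc (KInvStep (d := d) Lc j))
              (SrecAt d Lc (toSite r) ((Lc : ℝ) ^ (d + 1)) (-((Lc : ℝ) ^ (d + 1) * (1 / 2) * (Lc : ℝ) ^ (d + 1))) cΛ j) κ u) μ (toSite rr))
            yw.1 yw.2 (Sum.inl α) (Sum.inl μ) = 0 := by
  haveI : NeZero (Lc * N) := ⟨Nat.mul_ne_zero (NeZero.ne Lc) (NeZero.ne N)⟩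
  obtain ⟨Cs, CX, m, hm, hS, hX⟩ := exists_common_rate (d := d) hr sf sm cE cΛ j
  rw [swapWord_eq_directWord (N := Lc * N) hS hX hm
      (fun κ t s => sectorE_translate (r := r) sf sm cE cΛ j κ t (((Lc * N : ℕ) : ℤ) • s))
      (fun s => dressedStep_invariant_deep (r := r) sf sm j N s) μ ν α μ]
  exact faceWordEE_deep_eq_zero_of_right_diag hr sf sm cE cΛ j N ν α μ

end SectorE

end Summit.QuantumFields.BalabanUV.Beta.GAN24.FaceWordEESwapDeep

end
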